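import Mathlib
import HarnessLib

/-!
# FunctionalMining — the director identity (A4) of X2C-ASYM-UB for the eigenvectors of `tS_j + E`

Search for candidate a priori estimates; no regularity claim. Cell `pub-nsfunc`, prove seat
(gen 21). Kernel form of the no-go seat's kernel candidate K-e (`NoGo/STAGING.md`; identity (A4) of
census-1's `X2C-ASYM-UB.md` §2, three-party pen census-1 × nogo × dict — not a cited fact). In the
orthonormal frame `(v, d, n)` of a sector, `S_j = m·diag(1, 1, −2)` and the symmetric perturbation
`E` has in-plane block `E_pp = ū I₂ + U`, `U = [[a, b], [b, −a]]` (traceless), column `w = (w_v, w_d)`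
and corner `e_nn`, so

  `M = tS_j + E = [[tm + ū + a, b, w_v], [b, tm + ū − a, w_d], [w_v, w_d, −2tm + e_nn]]`.

For two orthogonal eigenvectors `e_k = (x_k, y_k, z_k)`, `M e_k = λ_k e_k` (`k = 1, 2`), writing
`p_k = (x_k, y_k)`:

* `Director.inner_Sj` — (A3): `⟨e₂, S_j e₁⟩ = −3m z₁z₂`;
* **`Director.director_identity`** — (A4): `⟨p₂, U p₁⟩ = −z₁z₂ (λ₁ + λ₂ + tm − ū − e_nn)`
  ("the in-plane eigenvectors diagonalise the director part `U` up to the rank-one scale").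

Only the eigen-equations and orthogonality are used (no normalisation, no sign or size hypothesis);
the proof is one `linear_combination`: with `rᵢ` the rows of `M e₁ = λ₁e₁`, `r₃′` the third row of
`M e₂ = λ₂ e₂` and `o` the orthogonality, `(A4) = x₂ r₁ + y₂ r₂ − z₁ r₃′ − (tm + ū − λ₁) o`.
[ours; folklore]
-/

noncomputable section

open Matrix

namespace Summit.NavierStokesRegularity.FunctionalMining

namespace Director

/-- (A3) of X2C-ASYM-UB: for orthogonal `e₁, e₂` and `S_j = m·diag(1,1,−2)`,
`⟨e₂, S_j e₁⟩ = −3m z₁ z₂`. [folklore] -/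
theorem inner_Sj {m : ℝ} {e₁ e₂ : Fin 3 → ℝ} (ho : e₁ ⬝ᵥ e₂ = 0) :
    e₂ ⬝ᵥ (!![m, 0, 0; 0, m, 0; 0, 0, -2 * m] *ᵥ e₁) = -3 * m * e₁ 2 * e₂ 2 := by
  simp [Matrix.mulVec, dotProduct, Fin.sum_univ_three] at ho ⊢
  linear_combination m * ho

/-- **(A4) DIRECTOR IDENTITY of X2C-ASYM-UB (kernel candidate K-e).** For
`M = [[tm + ū + a, b, w_v], [b, tm + ū − a, w_d], [w_v, w_d, −2tm + e_nn]]` and orthogonal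
eigenvectors `M e₁ = λ₁ e₁`, `M e₂ = λ₂ e₂`:
`a (x₁x₂ − y₁y₂) + b (x₂y₁ + x₁y₂) = −z₁z₂ (λ₁ + λ₂ + tm − ū − e_nn)`, i.e.
`⟨p₂, U p₁⟩ = −z₁z₂(λ₁ + λ₂ + tm − ū − e_nn)` with `U = [[a, b], [b, −a]]`, `p_k = (x_k, y_k)`.
[folklore; X2C-ASYM-UB §2 (A4)] -/
theorem director_identity {t m ubar a b wv wd enn lam₁ lam₂ : ℝ} {e₁ e₂ : Fin 3 → ℝ}
    (h₁ : !![t * m + ubar + a, b, wv; b, t * m + ubar - a, wd; wv, wd, -2 * (t * m) + enn] *ᵥ e₁ =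
      lam₁ • e₁)
    (h₂ : !![t * m + ubar + a, b, wv; b, t * m + ubar - a, wd; wv, wd, -2 * (t * m) + enn] *ᵥ e₂ =
      lam₂ • e₂)
    (ho : e₁ ⬝ᵥ e₂ = 0) :
    a * (e₁ 0 * e₂ 0 - e₁ 1 * e₂ 1) + b * (e₂ 0 * e₁ 1 + e₁ 0 * e₂ 1) =
      -(e₁ 2 * e₂ 2) * (lam₁ + lam₂ + t * m - ubar - enn) := by
  have r1 := congrFun h₁ 0
  have r2 := congrFun h₁ 1
  have r3' := congrFun h₂ 2
  simp [Matrix.mulVec, dotProduct, Fin.sum_univ_three] at r1 r2 r3' ho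
  linear_combination e₂ 0 * r1 + e₂ 1 * r2 - e₁ 2 * r3' - (t * m + ubar - lam₁) * ho

/-- The in-plane matrix form of (A4): `p₂ᵀ U p₁` with `U = [[a, b], [b, −a]]`. [folklore] -/
theorem director_identity' {t m ubar a b wv wd enn lam₁ lam₂ : ℝ} {e₁ e₂ : Fin 3 → ℝ}
    (h₁ : !![t * m + ubar + a, b, wv; b, t * m + ubar - a, wd; wv, wd, -2 * (t * m) + enn] *ᵥ e₁ =
      lam₁ • e₁)
    (h₂ : !![t * m + ubar + a, b, wv; b, t * m + ubar - a, wd; wv, wd, -2 * (t * m) + enn] *ᵥ e₂ =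
      lam₂ • e₂)
    (ho : e₁ ⬝ᵥ e₂ = 0) :
    ![e₂ 0, e₂ 1] ⬝ᵥ (!![a, b; b, -a] *ᵥ ![e₁ 0, e₁ 1]) =
      -(e₁ 2 * e₂ 2) * (lam₁ + lam₂ + t * m - ubar - enn) := by
  have h := director_identity h₁ h₂ ho
  simp [Matrix.mulVec, dotProduct, Fin.sum_univ_two]
  linear_combination h

end Director

end Summit.NavierStokesRegularity.FunctionalMining

end
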